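import Summits.SmoothPoincare4.SmoothPoincare4.Theorems.EntropyRungNoncompactShrinkerGapHeatFlatCorrector
import Summits.SmoothPoincare4.SmoothPoincare4.Theorems.EntropyRungNoncompactShrinkerGapHeatLinearHeat
import Summits.SmoothPoincare4.SmoothPoincare4.Theorems.EntropyRungNoncompactShrinkerGapHeatMaxPrincipleAux
import Literature.Geometry.Riemannian.WeightedHeatFlowFromLinearHeat
import HarnessLib

/-!
# The weighted heat flow from a compactly perturbed constant on a complete weighted manifold with
# Laplacian cut-offs (crux `EntropyRung.NoncompactShrinkerGap`, stmt-SmoothPoincare4-10868,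
# line `collapsed-ends-usc`, skeleton v13)

Registered helpers `helper_heatFlowExistence_of` and `helper_heatFlowExistence` of the stub
`stub_compactSupportLSI` (heat-flow proof of the compact-support logarithmic Sobolev inequality on the complete
shrinker). Setting: `(M, g)` Riemannian, modelled on `ℝⁿ` (Hausdorff, second countable, `T₃` — NOT compact),
`V` smooth with `¼|∇V|² − ½ΔV + λ ≥ 1`, Laplacian cut-offs `η_k` (`|Δη_k| ≤ C`). For `c₀ ∈ ℝ`, `ψ₀ ∈ C_c^∞(M)`
and `T > 0` there is `ρ`, smooth on `M × O` (`O ⊇ [0, T]` open), with `ρ(0) = c₀ + ψ₀`,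
`∂ₛρ = Δρ − g⁻¹(dV, dρ)` on `[0, T]`, and `(ρ − c₀)² e^{-V} ∈ L¹(M × (0, T))`.

Proof: with the potential `Q = ¼|∇V|² − ½ΔV + λ ≥ 1` and the datum `w₀ = e^{-V/2} ψ₀ ∈ C_c^∞`, the flat
corrector (`helper_flatCorrector_noncompact`) and the linear Cauchy problem (`helper_linearHeat_noncompact`) give
`w` smooth on `M × O` with `∂ₛw = Δw − Qw`, `w(0) = w₀`, `w ∈ L²` of the strip; then
`ρ = c₀ + e^{V/2} e^{λs} w`: the time shift removes `λ`, and the conjugation by `e^{V/2}` turns the potential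
`¼|∇V|² − ½ΔV` into the drift (`heatDrift_of_potential`, Literature); finally
`(ρ − c₀)² e^{-V} = e^{2λs} w² ≤ e^{2|λ|T} w²`.

References: F. Trèves, *Basic Linear Partial Differential Equations* (1975), §41 ((41.9): the exponential
shift); D. Bakry, I. Gentil, M. Ledoux (2014), §1.15.7 (the `h`-transform `L = e^{V/2} (Δ − Q) e^{-V/2}`).
-/

noncomputable section

set_option linter.dupNamespace false

open scoped Manifold ContDiff ENNReal NNReal Topology
open MeasureTheory Set Filter
open Literature.Geometry.Lorentzian Literature.Geometry.Riemannian

namespace Summit.SmoothPoincare4.SmoothPoincare4.Theorems.NoncompactShrinkerGapHeat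

/-- **Helper `helper_heatFlowExistence_of`** (line `collapsed-ends-usc`, v13; see the module docstring): the
weighted heat flow from `c₀ + ψ₀` GIVEN the flat corrector and the linear Cauchy solver as hypotheses
(exponential shift + conjugation by `e^{V/2}`). [cite: Treves1975, §41, (41.9)] -/
theorem helper_heatFlowExistence_of : ∀ (n : ℕ) (M : Type*) [TopologicalSpace M] [T2Space M] [SecondCountableTopology M] [ChartedSpace (EuclideanSpace ℝ (Fin n)) M] [IsManifold (𝓡 n) ∞ M] [T3Space M] [MeasurableSpace M] [BorelSpace M] (g : PseudoRiemannianMetric (𝓡 n) ∞ (EuclideanSpace ℝ (Fin n)) (TangentSpace (𝓡 n) : M → Type _)) [g.HasLeviCivita] (V : M → ℝ) (lam : ℝ), g.IsRiemannian → ContMDiff (𝓡 n) 𝓘(ℝ, ℝ) ∞ V → (∀ x, 1 ≤ g.gradSq V x / 4 - g.dalembertian V x / 2 + lam) → (∀ (Q : ℝ → M → ℝ), ContMDiff ((𝓡 n).prod 𝓘(ℝ, ℝ)) 𝓘(ℝ, ℝ) ∞ (fun p : M × ℝ ↦ Q p.2 p.1) → ∀ (w₀ : M → ℝ), ContMDiff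 (𝓡 n) 𝓘(ℝ, ℝ) ∞ w₀ → HasCompactSupport w₀ → ∃ (W G : ℝ → M → ℝ) (K : Set M), IsCompact K ∧ ContMDiff ((𝓡 n).prod 𝓘(ℝ, ℝ)) 𝓘(ℝ, ℝ) ∞ (fun p : M × ℝ ↦ W p.2 p.1) ∧ ContMDiff ((𝓡 n).prod 𝓘(ℝ, ℝ)) 𝓘(ℝ, ℝ) ∞ (fun p : M × ℝ ↦ G p.2 p.1) ∧ W 0 = w₀ ∧ (∀ s x, x ∉ K → W s x = 0) ∧ (∀ s x, x ∉ K → G s x = 0) ∧ (∀ s, 1 ≤ s → ∀ x, W s x = 0 ∧ G s x = 0) ∧ (∀ s ≤ 0, ∀ x, G s x = 0) ∧ ∀ s, 0 ≤ s → ∀ x, G s x = -(deriv (fun r ↦ W r x) s - (g.laplaceBeltrami (W s) x - Q s x * W s x))) → (∀ (Q : ℝ → M → ℝ), ContMDiff ((𝓡 n).prod 𝓘(ℝ, ℝ)) 𝓘(ℝ, ℝ) ∞ (fun p : M × ℝ ↦ Q p.2 p.1) → (∀ s x, 1 ≤ Q s x) → ∀ (W G : ℝ → M → ℝ) (K : Set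 M), IsCompact K → ContMDiff ((𝓡 n).prod 𝓘(ℝ, ℝ)) 𝓘(ℝ, ℝ) ∞ (fun p : M × ℝ ↦ W p.2 p.1) → ContMDiff ((𝓡 n).prod 𝓘(ℝ, ℝ)) 𝓘(ℝ, ℝ) ∞ (fun p : M × ℝ ↦ G p.2 p.1) → (∀ s x, x ∉ K → W s x = 0) → (∀ s x, x ∉ K → G s x = 0) → (∀ s, 1 ≤ s → ∀ x, W s x = 0 ∧ G s x = 0) → (∀ s ≤ 0, ∀ x, G s x = 0) → (∀ s, 0 ≤ s → ∀ x, G s x = -(deriv (fun r ↦ W r x) s - (g.laplaceBeltrami (W s) x - Q s x * W s x))) → ∀ T : ℝ, 0 < T → ∃ (O : Set ℝ) (w : ℝ → M → ℝ), IsOpen O ∧ Icc 0 T ⊆ O ∧ ContMDiffOn ((𝓡 n).prod 𝓘(ℝ, ℝ)) 𝓘(ℝ, ℝ) ∞ (fun p : M × ℝ ↦ w p.2 p.1) (univ ×ˢ O) ∧ (∀ x, w 0 x = W 0 x) ∧ (∀ s ∈ Icc 0 T, ∀ x, deriv (fun r ↦ w r x) s = g.dalembertian (w s) x - Q s x * w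 s x) ∧ Integrable (fun p : M × ℝ ↦ w p.2 p.1 ^ 2) ((g.riemVolume.prod (volume : Measure ℝ)).restrict (univ ×ˢ Ioo 0 T))) → ∀ (c₀ : ℝ) (ψ₀ : M → ℝ), ContMDiff (𝓡 n) 𝓘(ℝ, ℝ) ∞ ψ₀ → HasCompactSupport ψ₀ → ∀ T : ℝ, 0 < T → ∃ (O : Set ℝ) (ρ : ℝ → M → ℝ), IsOpen O ∧ Icc 0 T ⊆ O ∧ ContMDiffOn ((𝓡 n).prod 𝓘(ℝ, ℝ)) 𝓘(ℝ, ℝ) ∞ (fun p : M × ℝ ↦ ρ p.2 p.1) (univ ×ˢ O) ∧ (∀ x, ρ 0 x = c₀ + ψ₀ x) ∧ (∀ s ∈ Icc 0 T, ∀ x, deriv (fun r ↦ ρ r x) s = g.dalembertian (ρ s) x - g.innerDual x (mvfderiv (𝓡 n) V x).toLinearMap (mvfderiv (𝓡 n) (ρ s) x).toLinearMap) ∧ Integrable (fun p : M × ℝ ↦ (ρ p.2 p.1 - c₀) ^ 2 * Real.exp (-V p.1)) ((g.riemVolume.prod (volume : Measure ℝ)).restrict (univ ×ˢ Ioo 0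 T)) := by
  intro n M _ _ _ _ _ _ _ _ g _ V lam hg hV hlam HFC HLH c₀ ψ₀ hψ hψc T hT
  classical
  -- the potential `Q = ¼|∇V|² − ½ΔV + λ ≥ 1` (time independent)
  set Q : ℝ → M → ℝ := fun _ x ↦ g.gradSq V x / 4 - g.dalembertian V x / 2 + lam with hQdef
  have hQs : ContMDiff ((𝓡 n).prod 𝓘(ℝ, ℝ)) 𝓘(ℝ, ℝ) ∞ (fun p : M × ℝ ↦ Q p.2 p.1) := by
    have h1 : ContMDiff (𝓡 n) 𝓘(ℝ, ℝ) ∞ (fun x ↦ g.gradSq V x / 4 - g.dalembertian V x / 2 + lam) :=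
      (((contMDiff_gradSq g hV).div_const 4).sub ((contMDiff_dalembertian g hV).div_const 2)).add
        contMDiff_const
    exact h1.comp contMDiff_fst
  have hQ1 : ∀ s x, 1 ≤ Q s x := fun s x ↦ hlam x
  -- the datum `w₀ = e^{-V/2} ψ₀`
  set w₀ : M → ℝ := fun x ↦ Real.exp (-(V x / 2)) * ψ₀ x with hw₀def
  have hw₀ : ContMDiff (𝓡 n) 𝓘(ℝ, ℝ) ∞ w₀ :=
    ((contMDiff_iff_contDiff.2 Real.contDiff_exp).comp (hV.div_const 2).neg).mul hψ
  have hw₀c : HasCompactSupport w₀ := hψc.mul_left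
  -- the flat corrector and the linear Cauchy problem
  obtain ⟨W, G, K, hK, hW, hG, hW0, hWK, hGK, hWG1, hG0, hGW⟩ := HFC Q hQs w₀ hw₀ hw₀c
  obtain ⟨O, w, hO, hTO, hws, hw0, hweq, hwL2⟩ :=
    HLH Q hQs hQ1 W G K hK hW hG hWK hGK hWG1 hG0 hGW T hT
  -- the candidate `ρ = c₀ + e^{V/2} e^{λ s} w`
  set u : ℝ → M → ℝ := fun s x ↦ Real.exp (V x / 2) * (Real.exp (lam * s) * w s x) with hudef
  set ρ : ℝ → M → ℝ := fun s x ↦ 1 * u s x + c₀ with hρdef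
  have hus : ContMDiffOn ((𝓡 n).prod 𝓘(ℝ, ℝ)) 𝓘(ℝ, ℝ) ∞ (fun p : M × ℝ ↦ u p.2 p.1) (univ ×ˢ O) := by
    have hE : ContMDiff ((𝓡 n).prod 𝓘(ℝ, ℝ)) 𝓘(ℝ, ℝ) ∞ (fun p : M × ℝ ↦ Real.exp (V p.1 / 2)) :=
      ((contMDiff_iff_contDiff.2 Real.contDiff_exp).comp ((hV.comp contMDiff_fst).div_const 2))
    have hL : ContMDiff ((𝓡 n).prod 𝓘(ℝ, ℝ)) 𝓘(ℝ, ℝ) ∞ (fun p : M × ℝ ↦ Real.exp (lam * p.2)) :=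
      (contMDiff_iff_contDiff.2 Real.contDiff_exp).comp (contMDiff_const.mul contMDiff_snd)
    exact hE.contMDiffOn.mul (hL.contMDiffOn.mul hws)
  have hρs : ContMDiffOn ((𝓡 n).prod 𝓘(ℝ, ℝ)) 𝓘(ℝ, ℝ) ∞ (fun p : M × ℝ ↦ ρ p.2 p.1) (univ ×ˢ O) :=
    (contMDiffOn_const.mul hus).add contMDiffOn_const
  refine ⟨O, ρ, hO, hTO, hρs, fun x ↦ ?_, fun s hs x ↦ ?_, ?_⟩
  · -- `ρ(0) = c₀ + ψ₀`
    have h1 : Real.exp (V x / 2) * Real.exp (-(V x / 2)) = 1 := by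
      rw [← Real.exp_add]; simp
    simp only [hρdef, hudef, hw0, hW0, hw₀def, mul_zero, Real.exp_zero, one_mul]
    calc Real.exp (V x / 2) * (Real.exp (-(V x / 2)) * ψ₀ x) + c₀
        = (Real.exp (V x / 2) * Real.exp (-(V x / 2))) * ψ₀ x + c₀ := by ring
      _ = c₀ + ψ₀ x := by rw [h1]; ring
  · -- the equation: exponential shift, then conjugation by `e^{V/2}`
    have hsO : s ∈ O := hTO hs
    have h2 : (2 : ℕ∞ω) ≤ (∞ : ℕ∞ω) := by norm_cast
    have hslice : ContMDiff (𝓡 n) 𝓘(ℝ, ℝ) ∞ (w s) :=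
      hws.comp_contMDiff (contMDiff_id.prodMk contMDiff_const) fun y ↦ ⟨mem_univ _, hsO⟩
    have hws2 : ContMDiffAt (𝓡 n) 𝓘(ℝ, ℝ) 2 (w s) x := (hslice.of_le h2).contMDiffAt
    -- the shifted function `w̃ = e^{λ s} w`
    set wt : ℝ → M → ℝ := fun r y ↦ Real.exp (lam * r) * w r y with hwtdef
    have hwt2 : ContMDiffAt (𝓡 n) 𝓘(ℝ, ℝ) 2 (wt s) x := (contMDiffAt_const.mul hws2 :)
    have hdw : HasDerivAt (fun r ↦ w r x) (g.dalembertian (w s) x - Q s x * w s x) s := by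
      rw [← hweq s hs x]
      exact CutoffToolkit.hasDerivAt_time hO hws x hsO
    have hdE : HasDerivAt (fun r : ℝ ↦ Real.exp (lam * r)) (lam * Real.exp (lam * s)) s := by
      have := ((hasDerivAt_id s).const_mul lam).exp
      simpa [mul_comm] using this
    have hdwt : HasDerivAt (fun r ↦ wt r x)
        (g.dalembertian (wt s) x - (g.gradSq V x / 4 - g.dalembertian V x / 2) * wt s x) s := by
      have h := hdE.mul hdw
      have hΔ : g.dalembertian (wt s) x = Real.exp (lam * s) * g.dalembertian (w s) x := by
        show g.dalembertian (fun y ↦ Real.exp (lam * s) * w s y) x = _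
        exact g.dalembertian_const_mul_of_contMDiffAt hws2 _
      rw [hΔ]
      refine h.congr_deriv ?_
      simp only [hwtdef, hQdef]
      ring
    have hconj := heatDrift_of_potential g hV (S := univ) hwt2 hdwt.hasDerivWithinAt
    have hdu : HasDerivAt (fun r ↦ u r x)
        (g.dalembertian (u s) x - g.innerDual x (mvfderiv (𝓡 n) V x).toLinearMap
          (mvfderiv (𝓡 n) (u s) x).toLinearMap) s := by
      have h := hconj.hasDerivAt (Filter.univ_mem)
      simpa [hudef, hwtdef] using h
    have hdρ : HasDerivAt (fun r ↦ ρ r x)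
        (1 * (g.dalembertian (u s) x - g.innerDual x (mvfderiv (𝓡 n) V x).toLinearMap
          (mvfderiv (𝓡 n) (u s) x).toLinearMap)) s := by
      have := (hdu.const_mul 1).add_const c₀
      simpa [hρdef] using this
    rw [hdρ.deriv]
    have hu2 : ContMDiffAt (𝓡 n) 𝓘(ℝ, ℝ) 2 (u s) x := by
      have hA : ContMDiffAt (𝓡 n) 𝓘(ℝ, ℝ) 2 (fun y ↦ Real.exp (V y / 2)) x :=
        (((contMDiff_iff_contDiff.2 Real.contDiff_exp).comp (hV.div_const 2)).of_le h2).contMDiffAt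
      exact hA.mul hwt2
    have haff := weightedLaplacian_affine (g := g) (V := V) hu2 1 c₀
    rw [show ρ s = fun y ↦ 1 * u s y + c₀ from rfl, haff]
  · -- `(ρ − c₀)² e^{-V} = e^{2λs} w² ≤ e^{2|λ|T} w²` on the strip
    have hmeasS : MeasurableSet ((univ : Set M) ×ˢ Ioo (0 : ℝ) T) := MeasurableSet.univ.prod measurableSet_Ioo
    refine (hwL2.const_mul (Real.exp (2 * |lam| * T))).mono' ?_ ?_
    · have hsub : (univ : Set M) ×ˢ Ioo (0 : ℝ) T ⊆ univ ×ˢ O :=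
        Set.prod_mono le_rfl fun s hs ↦ hTO (Ioo_subset_Icc_self hs)
      have hρc : ContinuousOn (fun p : M × ℝ ↦ ρ p.2 p.1) ((univ : Set M) ×ˢ Ioo (0 : ℝ) T) :=
        hρs.continuousOn.mono hsub
      have hc : ContinuousOn (fun p : M × ℝ ↦ (ρ p.2 p.1 - c₀) ^ 2 * Real.exp (-V p.1))
          ((univ : Set M) ×ˢ Ioo (0 : ℝ) T) :=
        ((hρc.sub continuousOn_const).pow 2).mul
          (Real.continuous_exp.comp (hV.continuous.comp continuous_fst).neg).continuousOn
      exact hc.aestronglyMeasurable hmeasS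
    · rw [ae_restrict_iff' hmeasS]
      refine Eventually.of_forall fun p hp ↦ ?_
      obtain ⟨-, hs⟩ := hp
      have h1 : (ρ p.2 p.1 - c₀) ^ 2 * Real.exp (-V p.1) = Real.exp (2 * (lam * p.2)) * w p.2 p.1 ^ 2 := by
        simp only [hρdef, hudef]
        have hE : Real.exp (V p.1 / 2) ^ 2 * Real.exp (-V p.1) = 1 := by
          rw [sq, ← Real.exp_add, ← Real.exp_add]
          convert Real.exp_zero using 2
          ring
        have hL : Real.exp (lam * p.2) ^ 2 = Real.exp (2 * (lam * p.2)) := by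
          rw [sq, ← Real.exp_add]
          congr 1
          ring
        calc (1 * (Real.exp (V p.1 / 2) * (Real.exp (lam * p.2) * w p.2 p.1)) + c₀ - c₀) ^ 2 * Real.exp (-V p.1)
            = (Real.exp (V p.1 / 2) ^ 2 * Real.exp (-V p.1)) * (Real.exp (lam * p.2) ^ 2 * w p.2 p.1 ^ 2) := by
              ring
          _ = Real.exp (2 * (lam * p.2)) * w p.2 p.1 ^ 2 := by rw [hE, hL, one_mul]
      rw [Real.norm_eq_abs, h1, abs_of_nonneg (by positivity)]
      refine mul_le_mul_of_nonneg_right (Real.exp_le_exp.2 ?_) (sq_nonneg _)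
      have h3 : lam * p.2 ≤ |lam| * T := by
        calc lam * p.2 ≤ |lam| * p.2 := mul_le_mul_of_nonneg_right (le_abs_self _) hs.1.le
          _ ≤ |lam| * T := mul_le_mul_of_nonneg_left hs.2.le (abs_nonneg _)
      linarith

/-- **Helper `helper_heatFlowExistence`** (line `collapsed-ends-usc`, v13; see the module docstring): the weighted
heat flow `∂ₛρ = Δρ − g⁻¹(dV, dρ)` from `c₀ + ψ₀` on a complete weighted manifold with Laplacian cut-offs and
`¼|∇V|² − ½ΔV + λ ≥ 1` — `helper_heatFlowExistence_of` fed with `helper_flatCorrector_noncompact` and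
`helper_linearHeat_noncompact`. [cite: Treves1975, §41, Thm. 40.1] -/
theorem helper_heatFlowExistence : ∀ (n : ℕ) (M : Type*) [TopologicalSpace M] [T2Space M] [SecondCountableTopology M] [ChartedSpace (EuclideanSpace ℝ (Fin n)) M] [IsManifold (𝓡 n) ∞ M] [T3Space M] [MeasurableSpace M] [BorelSpace M] (g : PseudoRiemannianMetric (𝓡 n) ∞ (EuclideanSpace ℝ (Fin n)) (TangentSpace (𝓡 n) : M → Type _)) [g.HasLeviCivita] (V : M → ℝ) (lam : ℝ), g.IsRiemannian → ContMDiff (𝓡 n) 𝓘(ℝ, ℝ) ∞ V → (∀ x, 1 ≤ g.gradSq V x / 4 - g.dalembertian V x / 2 + lam) → ∀ (η : ℕ → M → ℝ) (C : ℝ), (∀ k, ContMDiff (𝓡 n) 𝓘(ℝ, ℝ) ∞ (η k)) → (∀ k, HasCompactSupport (η k)) → (∀ k x, 0 ≤ η k x ∧ η k x ≤ 1) → (∀ k x, η k x ≤ η (k + 1) x) → (∀ x, ∀ᶠ k in atTop, ∀ᶠ y in 𝓝 x, η k y = 1) → (∀ k x, |g.dalembertian (η k) x| ≤ C) → ∀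 (c₀ : ℝ) (ψ₀ : M → ℝ), ContMDiff (𝓡 n) 𝓘(ℝ, ℝ) ∞ ψ₀ → HasCompactSupport ψ₀ → ∀ T : ℝ, 0 < T → ∃ (O : Set ℝ) (ρ : ℝ → M → ℝ), IsOpen O ∧ Icc 0 T ⊆ O ∧ ContMDiffOn ((𝓡 n).prod 𝓘(ℝ, ℝ)) 𝓘(ℝ, ℝ) ∞ (fun p : M × ℝ ↦ ρ p.2 p.1) (univ ×ˢ O) ∧ (∀ x, ρ 0 x = c₀ + ψ₀ x) ∧ (∀ s ∈ Icc 0 T, ∀ x, deriv (fun r ↦ ρ r x) s = g.dalembertian (ρ s) x - g.innerDual x (mvfderiv (𝓡 n) V x).toLinearMap (mvfderiv (𝓡 n) (ρ s) x).toLinearMap) ∧ Integrable (fun p : M × ℝ ↦ (ρ p.2 p.1 - c₀) ^ 2 * Real.exp (-V p.1)) ((g.riemVolume.prod (volume : Measure ℝ)).restrict (univ ×ˢ Ioo 0 T)) := by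
  intro n M _ _ _ _ _ _ _ _ g _ V lam hg hV hlam η C hηs hηc hη01 hηmono hη1 hηΔ c₀ ψ₀ hψ hψc T hT
  exact helper_heatFlowExistence_of n M g V lam hg hV hlam
    (fun Q hQ w₀ hw₀ hw₀c ↦ helper_flatCorrector_noncompact n M g Q hQ w₀ hw₀ hw₀c)
    (fun Q hQ hQ1 W G K hK hW hG hWK hGK hWG1 hG0 hGW T hT ↦
      helper_linearHeat_noncompact n M g hg η C hηs hηc hη01 hηmono hη1 hηΔ Q hQ hQ1 W G K hK hW hG hWK hGK
        hWG1 hG0 hGW T hT)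
    c₀ ψ₀ hψ hψc T hT

end Summit.SmoothPoincare4.SmoothPoincare4.Theorems.NoncompactShrinkerGapHeat

end
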